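import Mathlib.Tactic.Ring
import Mathlib.Tactic.Linarith
import Mathlib.Tactic.Positivity
import Mathlib.Tactic.LinearCombination
import Mathlib.Data.Real.Basic
import Summits.HodgeConjecture.HodgeConjecture.Theorems.WeilClassTestFormatFiveThreeLineQuintic
import Summits.HodgeConjecture.HodgeConjecture.Theorems.WeilClassTestFormatFiveThreePattern044
import Summits.HodgeConjecture.HodgeConjecture.Theorems.WeilClassTestFormatFiveThreeTypes
import HarnessLib

/-!
# Conjecture N (hodge-weil ladder, GAPS G51b), format (5,3): TYPE REDUCTION FOR THE PATTERN (0,2,2)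

Prover 2, generation 18 (note `run/shared/lean/b2b/hodge-weil/b2b-hweil-pv2-g18/MOMENTS-G18.md`, ADDENDUM 1–2), completing
`WeilClassTestFormatFiveThreeTypes.lean`: on the sorted pattern (0,2,2) `v₁ < u₁ ≤ u₂ < v₂ ≤ v₃ < u₃ ≤ u₄ ≤ u₅` with `Q₄ < 0`, `ρ ≥ 0`,
`ρ² = S/2`: `u₂ < −ρ < u₅ < ρ` (`types_022`) — five types remain (`−ρ` in one of the five slots between `u₂` and `u₅`). Unlike the other
patterns this one needs the positions: the branches with `ℓ(u₅) ≥ 0` are killed either by a cubic test (three sign changes) or by the wall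
lemma in the form `no_config_of_walls_nonneg` (F-walls positive, E-walls nonnegative, one E-wall positive with a strict pair) proved here.
Pure algebra; nothing here is a case of HC, a rung or a door edge; no statement of Markman's papers is used. New cell result ⇒ Summits/.
-/

set_option linter.dupNamespace false

open Summit.HodgeConjecture.HodgeConjecture.WeilClassTestFormatFiveThreeLineQuintic
open Summit.HodgeConjecture.HodgeConjecture.WeilClassTestFormatFiveThreePattern044
open Summit.HodgeConjecture.HodgeConjecture.WeilClassTestFormatFiveThreeTypes

namespace Summit.HodgeConjecture.HodgeConjecture.WeilClassTestFormatFiveThreeTypes022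

set_option maxHeartbeats 4000000 in
/-- WALL LEMMA, mixed-sign-free variant: F-walls positive, E-walls nonnegative, the wall of `u₁` positive and the pair `(E₁,F₁)` strict
(`v₁ ≠ u₁`): impossible (transport identity: `0 = W·P2 = Σ w_e z_g (A_e − B_g)` with nonnegative terms forces `A₁ = B₁`, hence `u₁ = v₁`). -/
theorem no_config_of_walls_nonneg (A₁ A₂ A₃ A₄ A₅ B₁ B₂ B₃ u₁ u₂ u₃ u₄ u₅ v₁ v₂ v₃ : ℝ)
    (hA : A₁ + A₂ + A₃ + A₄ + A₅ = B₁ + B₂ + B₃)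
    (hP2 : (A₁ * u₁ ^ 2 + A₂ * u₂ ^ 2 + A₃ * u₃ ^ 2 + A₄ * u₄ ^ 2 + A₅ * u₅ ^ 2) - (B₁ * v₁ ^ 2 + B₂ * v₂ ^ 2 + B₃ * v₃ ^ 2) = 0)
    (m₁₁ : |u₁ - v₁| ≤ A₁ - B₁) (m₂₁ : |u₂ - v₁| ≤ A₂ - B₁) (m₃₁ : |u₃ - v₁| ≤ A₃ - B₁) (m₄₁ : |u₄ - v₁| ≤ A₄ - B₁) (m₅₁ : |u₅ - v₁| ≤ A₅ - B₁)
    (m₁₂ : |u₁ - v₂| ≤ A₁ - B₂) (m₂₂ : |u₂ - v₂| ≤ A₂ - B₂) (m₃₂ : |u₃ - v₂| ≤ A₃ - B₂) (m₄₂ : |u₄ - v₂| ≤ A₄ - B₂) (m₅₂ : |u₅ - v₂| ≤ A₅ - B₂)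
    (m₁₃ : |u₁ - v₃| ≤ A₁ - B₃) (m₂₃ : |u₂ - v₃| ≤ A₂ - B₃) (m₃₃ : |u₃ - v₃| ≤ A₃ - B₃) (m₄₃ : |u₄ - v₃| ≤ A₄ - B₃) (m₅₃ : |u₅ - v₃| ≤ A₅ - B₃)
    (hne : v₁ ≠ u₁)
    (hw₁ : 0 < (u₁ ^ 2 - ((u₁ ^ 2 + u₂ ^ 2 + u₃ ^ 2 + u₄ ^ 2 + u₅ ^ 2) - (v₁ ^ 2 + v₂ ^ 2 + v₃ ^ 2)) / 2)) (hw₂ : 0 ≤ (u₂ ^ 2 - ((u₁ ^ 2 + u₂ ^ 2 + u₃ ^ 2 + u₄ ^ 2 + u₅ ^ 2) - (v₁ ^ 2 + v₂ ^ 2 + v₃ ^ 2)) / 2)) (hw₃ : 0 ≤ (u₃ ^ 2 - ((u₁ ^ 2 + u₂ ^ 2 + u₃ ^ 2 + u₄ ^ 2 + u₅ ^ 2) - (v₁ ^ 2 + v₂ ^ 2 + v₃ ^ 2)) / 2)) (hw₄ : 0 ≤ (u₄ ^ 2 - ((u₁ ^ 2 + u₂ ^ 2 + u₃ ^ 2 +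 u₄ ^ 2 + u₅ ^ 2) - (v₁ ^ 2 + v₂ ^ 2 + v₃ ^ 2)) / 2)) (hw₅ : 0 ≤ (u₅ ^ 2 - ((u₁ ^ 2 + u₂ ^ 2 + u₃ ^ 2 + u₄ ^ 2 + u₅ ^ 2) - (v₁ ^ 2 + v₂ ^ 2 + v₃ ^ 2)) / 2))
    (hz₁ : 0 < (v₁ ^ 2 - ((u₁ ^ 2 + u₂ ^ 2 + u₃ ^ 2 + u₄ ^ 2 + u₅ ^ 2) - (v₁ ^ 2 + v₂ ^ 2 + v₃ ^ 2)) / 2)) (hz₂ : 0 < (v₂ ^ 2 - ((u₁ ^ 2 + u₂ ^ 2 + u₃ ^ 2 + u₄ ^ 2 + u₅ ^ 2) - (v₁ ^ 2 + v₂ ^ 2 + v₃ ^ 2)) / 2)) (hz₃ : 0 < (v₃ ^ 2 - ((u₁ ^ 2 + u₂ ^ 2 + u₃ ^ 2 + u₄ ^ 2 + u₅ ^ 2) - (v₁ ^ 2 + v₂ ^ 2 + v₃ ^ 2)) / 2)) : False := by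
  have hW : (u₁ ^ 2 - ((u₁ ^ 2 + u₂ ^ 2 + u₃ ^ 2 + u₄ ^ 2 + u₅ ^ 2) - (v₁ ^ 2 + v₂ ^ 2 + v₃ ^ 2)) / 2) + (u₂ ^ 2 - ((u₁ ^ 2 + u₂ ^ 2 + u₃ ^ 2 + u₄ ^ 2 + u₅ ^ 2) - (v₁ ^ 2 + v₂ ^ 2 + v₃ ^ 2)) / 2) + (u₃ ^ 2 - ((u₁ ^ 2 + u₂ ^ 2 + u₃ ^ 2 + u₄ ^ 2 + u₅ ^ 2) - (v₁ ^ 2 + v₂ ^ 2 + v₃ ^ 2)) / 2) + (u₄ ^ 2 - ((u₁ ^ 2 + u₂ ^ 2 + u₃ ^ 2 + u₄ ^ 2 + u₅ ^ 2) - (v₁ ^ 2 + v₂ ^ 2 + v₃ ^ 2)) / 2) + (u₅ ^ 2 - ((u₁ ^ 2 + u₂ ^ 2 + u₃ ^ 2 + u₄ ^ 2 + u₅ ^ 2) - (v₁ ^ 2 + v₂ ^ 2 + v₃ ^ 2)) / 2) = (v₁ ^ 2 - ((u₁ ^ 2 + u₂ ^ 2 + u₃ ^ 2 + u₄ ^ 2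 + u₅ ^ 2) - (v₁ ^ 2 + v₂ ^ 2 + v₃ ^ 2)) / 2) + (v₂ ^ 2 - ((u₁ ^ 2 + u₂ ^ 2 + u₃ ^ 2 + u₄ ^ 2 + u₅ ^ 2) - (v₁ ^ 2 + v₂ ^ 2 + v₃ ^ 2)) / 2) + (v₃ ^ 2 - ((u₁ ^ 2 + u₂ ^ 2 + u₃ ^ 2 + u₄ ^ 2 + u₅ ^ 2) - (v₁ ^ 2 + v₂ ^ 2 + v₃ ^ 2)) / 2) := by ring
  have hP2' : ((u₁ ^ 2 - ((u₁ ^ 2 + u₂ ^ 2 + u₃ ^ 2 + u₄ ^ 2 + u₅ ^ 2) - (v₁ ^ 2 + v₂ ^ 2 + v₃ ^ 2)) / 2) * A₁ + (u₂ ^ 2 - ((u₁ ^ 2 + u₂ ^ 2 + u₃ ^ 2 + u₄ ^ 2 + u₅ ^ 2) - (v₁ ^ 2 + v₂ ^ 2 + v₃ ^ 2)) / 2) * A₂ + (u₃ ^ 2 - ((u₁ ^ 2 + u₂ ^ 2 + u₃ ^ 2 + u₄ ^ 2 + u₅ ^ 2) - (v₁ ^ 2 + v₂ ^ 2 + v₃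 ^ 2)) / 2) * A₃ + (u₄ ^ 2 - ((u₁ ^ 2 + u₂ ^ 2 + u₃ ^ 2 + u₄ ^ 2 + u₅ ^ 2) - (v₁ ^ 2 + v₂ ^ 2 + v₃ ^ 2)) / 2) * A₄ + (u₅ ^ 2 - ((u₁ ^ 2 + u₂ ^ 2 + u₃ ^ 2 + u₄ ^ 2 + u₅ ^ 2) - (v₁ ^ 2 + v₂ ^ 2 + v₃ ^ 2)) / 2) * A₅)
      - ((v₁ ^ 2 - ((u₁ ^ 2 + u₂ ^ 2 + u₃ ^ 2 + u₄ ^ 2 + u₅ ^ 2) - (v₁ ^ 2 + v₂ ^ 2 + v₃ ^ 2)) / 2) * B₁ + (v₂ ^ 2 - ((u₁ ^ 2 + u₂ ^ 2 + u₃ ^ 2 + u₄ ^ 2 + u₅ ^ 2) - (v₁ ^ 2 + v₂ ^ 2 + v₃ ^ 2)) / 2) * B₂ + (v₃ ^ 2 - ((u₁ ^ 2 + u₂ ^ 2 + u₃ ^ 2 + u₄ ^ 2 + u₅ ^ 2) - (v₁ ^ 2 + v₂ ^ 2 + v₃ ^ 2)) / 2) * B₃) = 0 := by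
    have hB : B₃ = A₁ + A₂ + A₃ + A₄ + A₅ - B₁ - B₂ := by linarith
    subst hB
    linear_combination hP2
  have key := transport (u₁ ^ 2 - ((u₁ ^ 2 + u₂ ^ 2 + u₃ ^ 2 + u₄ ^ 2 + u₅ ^ 2) - (v₁ ^ 2 + v₂ ^ 2 + v₃ ^ 2)) / 2) (u₂ ^ 2 - ((u₁ ^ 2 + u₂ ^ 2 + u₃ ^ 2 + u₄ ^ 2 + u₅ ^ 2) - (v₁ ^ 2 + v₂ ^ 2 + v₃ ^ 2)) / 2) (u₃ ^ 2 - ((u₁ ^ 2 + u₂ ^ 2 + u₃ ^ 2 + u₄ ^ 2 + u₅ ^ 2) - (v₁ ^ 2 + v₂ ^ 2 + v₃ ^ 2)) / 2) (u₄ ^ 2 - ((u₁ ^ 2 + u₂ ^ 2 + u₃ ^ 2 + u₄ ^ 2 + u₅ ^ 2) - (v₁ ^ 2 + v₂ ^ 2 + v₃ ^ 2)) / 2) (u₅ ^ 2 - ((u₁ ^ 2 + u₂ ^ 2 + u₃ ^ 2 + u₄ ^ 2 + u₅ ^ 2) - (v₁ ^ 2 + v₂ ^ 2 + v₃ ^ 2))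 / 2) (v₁ ^ 2 - ((u₁ ^ 2 + u₂ ^ 2 + u₃ ^ 2 + u₄ ^ 2 + u₅ ^ 2) - (v₁ ^ 2 + v₂ ^ 2 + v₃ ^ 2)) / 2) (v₂ ^ 2 - ((u₁ ^ 2 + u₂ ^ 2 + u₃ ^ 2 + u₄ ^ 2 + u₅ ^ 2) - (v₁ ^ 2 + v₂ ^ 2 + v₃ ^ 2)) / 2) (v₃ ^ 2 - ((u₁ ^ 2 + u₂ ^ 2 + u₃ ^ 2 + u₄ ^ 2 + u₅ ^ 2) - (v₁ ^ 2 + v₂ ^ 2 + v₃ ^ 2)) / 2) A₁ A₂ A₃ A₄ A₅ B₁ B₂ B₃ hW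
  rw [hP2', mul_zero] at key
  have t₁₁ : 0 ≤ (u₁ ^ 2 - ((u₁ ^ 2 + u₂ ^ 2 + u₃ ^ 2 + u₄ ^ 2 + u₅ ^ 2) - (v₁ ^ 2 + v₂ ^ 2 + v₃ ^ 2)) / 2) * (v₁ ^ 2 - ((u₁ ^ 2 + u₂ ^ 2 + u₃ ^ 2 + u₄ ^ 2 + u₅ ^ 2) - (v₁ ^ 2 + v₂ ^ 2 + v₃ ^ 2)) / 2) * (A₁ - B₁) := mul_nonneg (mul_nonneg (le_of_lt hw₁) (le_of_lt hz₁)) ((abs_nonneg _).trans m₁₁)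
  have t₂₁ : 0 ≤ (u₂ ^ 2 - ((u₁ ^ 2 + u₂ ^ 2 + u₃ ^ 2 + u₄ ^ 2 + u₅ ^ 2) - (v₁ ^ 2 + v₂ ^ 2 + v₃ ^ 2)) / 2) * (v₁ ^ 2 - ((u₁ ^ 2 + u₂ ^ 2 + u₃ ^ 2 + u₄ ^ 2 + u₅ ^ 2) - (v₁ ^ 2 + v₂ ^ 2 + v₃ ^ 2)) / 2) * (A₂ - B₁) := mul_nonneg (mul_nonneg hw₂ (le_of_lt hz₁)) ((abs_nonneg _).trans m₂₁)
  have t₃₁ : 0 ≤ (u₃ ^ 2 - ((u₁ ^ 2 + u₂ ^ 2 + u₃ ^ 2 + u₄ ^ 2 + u₅ ^ 2) - (v₁ ^ 2 + v₂ ^ 2 + v₃ ^ 2)) / 2) * (v₁ ^ 2 - ((u₁ ^ 2 + u₂ ^ 2 + u₃ ^ 2 + u₄ ^ 2 + u₅ ^ 2) - (v₁ ^ 2 + v₂ ^ 2 + v₃ ^ 2)) / 2) * (A₃ - B₁) := mul_nonneg (mul_nonneg hw₃ (le_of_lt hz₁)) ((abs_nonneg _).trans m₃₁)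
  have t₄₁ : 0 ≤ (u₄ ^ 2 - ((u₁ ^ 2 + u₂ ^ 2 + u₃ ^ 2 + u₄ ^ 2 + u₅ ^ 2) - (v₁ ^ 2 + v₂ ^ 2 + v₃ ^ 2)) / 2) * (v₁ ^ 2 - ((u₁ ^ 2 + u₂ ^ 2 + u₃ ^ 2 + u₄ ^ 2 + u₅ ^ 2) - (v₁ ^ 2 + v₂ ^ 2 + v₃ ^ 2)) / 2) * (A₄ - B₁) := mul_nonneg (mul_nonneg hw₄ (le_of_lt hz₁)) ((abs_nonneg _).trans m₄₁)
  have t₅₁ : 0 ≤ (u₅ ^ 2 - ((u₁ ^ 2 + u₂ ^ 2 + u₃ ^ 2 + u₄ ^ 2 + u₅ ^ 2) - (v₁ ^ 2 + v₂ ^ 2 + v₃ ^ 2)) / 2) * (v₁ ^ 2 - ((u₁ ^ 2 + u₂ ^ 2 + u₃ ^ 2 + u₄ ^ 2 + u₅ ^ 2) - (v₁ ^ 2 + v₂ ^ 2 + v₃ ^ 2)) / 2) * (A₅ - B₁) := mul_nonneg (mul_nonneg hw₅ (le_of_lt hz₁)) ((abs_nonneg _).trans m₅₁)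
  have t₁₂ : 0 ≤ (u₁ ^ 2 - ((u₁ ^ 2 + u₂ ^ 2 + u₃ ^ 2 + u₄ ^ 2 + u₅ ^ 2) - (v₁ ^ 2 + v₂ ^ 2 + v₃ ^ 2)) / 2) * (v₂ ^ 2 - ((u₁ ^ 2 + u₂ ^ 2 + u₃ ^ 2 + u₄ ^ 2 + u₅ ^ 2) - (v₁ ^ 2 + v₂ ^ 2 + v₃ ^ 2)) / 2) * (A₁ - B₂) := mul_nonneg (mul_nonneg (le_of_lt hw₁) (le_of_lt hz₂)) ((abs_nonneg _).trans m₁₂)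
  have t₂₂ : 0 ≤ (u₂ ^ 2 - ((u₁ ^ 2 + u₂ ^ 2 + u₃ ^ 2 + u₄ ^ 2 + u₅ ^ 2) - (v₁ ^ 2 + v₂ ^ 2 + v₃ ^ 2)) / 2) * (v₂ ^ 2 - ((u₁ ^ 2 + u₂ ^ 2 + u₃ ^ 2 + u₄ ^ 2 + u₅ ^ 2) - (v₁ ^ 2 + v₂ ^ 2 + v₃ ^ 2)) / 2) * (A₂ - B₂) := mul_nonneg (mul_nonneg hw₂ (le_of_lt hz₂)) ((abs_nonneg _).trans m₂₂)
  have t₃₂ : 0 ≤ (u₃ ^ 2 - ((u₁ ^ 2 + u₂ ^ 2 + u₃ ^ 2 + u₄ ^ 2 + u₅ ^ 2) - (v₁ ^ 2 + v₂ ^ 2 + v₃ ^ 2)) / 2) * (v₂ ^ 2 - ((u₁ ^ 2 + u₂ ^ 2 + u₃ ^ 2 + u₄ ^ 2 + u₅ ^ 2) - (v₁ ^ 2 + v₂ ^ 2 + v₃ ^ 2)) / 2) * (A₃ - B₂) := mul_nonneg (mul_nonneg hw₃ (le_of_lt hz₂)) ((abs_nonneg _).trans m₃₂)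
  have t₄₂ : 0 ≤ (u₄ ^ 2 - ((u₁ ^ 2 + u₂ ^ 2 + u₃ ^ 2 + u₄ ^ 2 + u₅ ^ 2) - (v₁ ^ 2 + v₂ ^ 2 + v₃ ^ 2)) / 2) * (v₂ ^ 2 - ((u₁ ^ 2 + u₂ ^ 2 + u₃ ^ 2 + u₄ ^ 2 + u₅ ^ 2) - (v₁ ^ 2 + v₂ ^ 2 + v₃ ^ 2)) / 2) * (A₄ - B₂) := mul_nonneg (mul_nonneg hw₄ (le_of_lt hz₂)) ((abs_nonneg _).trans m₄₂)
  have t₅₂ : 0 ≤ (u₅ ^ 2 - ((u₁ ^ 2 + u₂ ^ 2 + u₃ ^ 2 + u₄ ^ 2 + u₅ ^ 2) - (v₁ ^ 2 + v₂ ^ 2 + v₃ ^ 2)) / 2) * (v₂ ^ 2 - ((u₁ ^ 2 + u₂ ^ 2 + u₃ ^ 2 + u₄ ^ 2 + u₅ ^ 2) - (v₁ ^ 2 + v₂ ^ 2 + v₃ ^ 2)) / 2) * (A₅ - B₂) := mul_nonneg (mul_nonneg hw₅ (le_of_lt hz₂)) ((abs_nonneg _).trans m₅₂)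
  have t₁₃ : 0 ≤ (u₁ ^ 2 - ((u₁ ^ 2 + u₂ ^ 2 + u₃ ^ 2 + u₄ ^ 2 + u₅ ^ 2) - (v₁ ^ 2 + v₂ ^ 2 + v₃ ^ 2)) / 2) * (v₃ ^ 2 - ((u₁ ^ 2 + u₂ ^ 2 + u₃ ^ 2 + u₄ ^ 2 + u₅ ^ 2) - (v₁ ^ 2 + v₂ ^ 2 + v₃ ^ 2)) / 2) * (A₁ - B₃) := mul_nonneg (mul_nonneg (le_of_lt hw₁) (le_of_lt hz₃)) ((abs_nonneg _).trans m₁₃)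
  have t₂₃ : 0 ≤ (u₂ ^ 2 - ((u₁ ^ 2 + u₂ ^ 2 + u₃ ^ 2 + u₄ ^ 2 + u₅ ^ 2) - (v₁ ^ 2 + v₂ ^ 2 + v₃ ^ 2)) / 2) * (v₃ ^ 2 - ((u₁ ^ 2 + u₂ ^ 2 + u₃ ^ 2 + u₄ ^ 2 + u₅ ^ 2) - (v₁ ^ 2 + v₂ ^ 2 + v₃ ^ 2)) / 2) * (A₂ - B₃) := mul_nonneg (mul_nonneg hw₂ (le_of_lt hz₃)) ((abs_nonneg _).trans m₂₃)
  have t₃₃ : 0 ≤ (u₃ ^ 2 - ((u₁ ^ 2 + u₂ ^ 2 + u₃ ^ 2 + u₄ ^ 2 + u₅ ^ 2) - (v₁ ^ 2 + v₂ ^ 2 + v₃ ^ 2)) / 2) * (v₃ ^ 2 - ((u₁ ^ 2 + u₂ ^ 2 + u₃ ^ 2 + u₄ ^ 2 + u₅ ^ 2) - (v₁ ^ 2 + v₂ ^ 2 + v₃ ^ 2)) / 2) * (A₃ - B₃) := mul_nonneg (mul_nonneg hw₃ (le_of_lt hz₃)) ((abs_nonneg _).trans m₃₃)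
  have t₄₃ : 0 ≤ (u₄ ^ 2 - ((u₁ ^ 2 + u₂ ^ 2 + u₃ ^ 2 + u₄ ^ 2 + u₅ ^ 2) - (v₁ ^ 2 + v₂ ^ 2 + v₃ ^ 2)) / 2) * (v₃ ^ 2 - ((u₁ ^ 2 + u₂ ^ 2 + u₃ ^ 2 + u₄ ^ 2 + u₅ ^ 2) - (v₁ ^ 2 + v₂ ^ 2 + v₃ ^ 2)) / 2) * (A₄ - B₃) := mul_nonneg (mul_nonneg hw₄ (le_of_lt hz₃)) ((abs_nonneg _).trans m₄₃)
  have t₅₃ : 0 ≤ (u₅ ^ 2 - ((u₁ ^ 2 + u₂ ^ 2 + u₃ ^ 2 + u₄ ^ 2 + u₅ ^ 2) - (v₁ ^ 2 + v₂ ^ 2 + v₃ ^ 2)) / 2) * (v₃ ^ 2 - ((u₁ ^ 2 + u₂ ^ 2 + u₃ ^ 2 + u₄ ^ 2 + u₅ ^ 2) - (v₁ ^ 2 + v₂ ^ 2 + v₃ ^ 2)) / 2) * (A₅ - B₃) := mul_nonneg (mul_nonneg hw₅ (le_of_lt hz₃)) ((abs_nonneg _).trans m₅₃)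
  have h11 : (u₁ ^ 2 - ((u₁ ^ 2 + u₂ ^ 2 + u₃ ^ 2 + u₄ ^ 2 + u₅ ^ 2) - (v₁ ^ 2 + v₂ ^ 2 + v₃ ^ 2)) / 2) * (v₁ ^ 2 - ((u₁ ^ 2 + u₂ ^ 2 + u₃ ^ 2 + u₄ ^ 2 + u₅ ^ 2) - (v₁ ^ 2 + v₂ ^ 2 + v₃ ^ 2)) / 2) * (A₁ - B₁) = 0 := by
    linarith [key, t₁₁, t₂₁, t₃₁, t₄₁, t₅₁, t₁₂, t₂₂, t₃₂, t₄₂, t₅₂, t₁₃, t₂₃, t₃₃, t₄₃, t₅₃]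
  have hAB : A₁ - B₁ = 0 := by
    rcases mul_eq_zero.mp h11 with h | h
    · exfalso
      have := mul_pos hw₁ hz₁
      linarith
    · exact h
  have hm := m₁₁
  rw [hAB] at hm
  have : u₁ - v₁ = 0 := abs_nonpos_iff.mp hm
  exact hne (by linarith)

/-- wall helper: a nonnegative wall puts the charge outside the open interval `(−ρ, ρ)`. -/
theorem outside_of_wall_nonneg (x ρ s : ℝ) (hρ2 : ρ ^ 2 = s / 2) (hw : 0 ≤ x ^ 2 - s / 2) : x ≤ -ρ ∨ ρ ≤ x := by
  rcases le_or_gt x (-ρ) with h1 | h1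
  · exact Or.inl h1
  · rcases le_or_gt ρ x with h2 | h2
    · exact Or.inr h2
    · exfalso
      have e : x ^ 2 - s / 2 = (x - ρ) * (x + ρ) := by linear_combination hρ2
      have : (x - ρ) * (x + ρ) < 0 := mul_neg_of_neg_of_pos (by linarith) (by linarith)
      linarith

set_option maxHeartbeats 4000000 in
/-- TYPE REDUCTION for (0,2,2) (`v₁ < u₁ ≤ u₂ < v₂ ≤ v₃ < u₃ ≤ u₄ ≤ u₅`, `Q₄ < 0`, `ρ ≥ 0`, `ρ² = S/2`; centred, `P2 = P4 = 0`, pairwise ample):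
`u₂ < −ρ`, `−ρ < u₅`, `u₅ < ρ` — five types remain (`−ρ` against `v₂, v₃, u₃, u₄`). -/
theorem types_022 (A₁ A₂ A₃ A₄ A₅ B₁ B₂ B₃ u₁ u₂ u₃ u₄ u₅ v₁ v₂ v₃ ρ : ℝ)
    (hA : A₁ + A₂ + A₃ + A₄ + A₅ = B₁ + B₂ + B₃) (hC : u₁ + u₂ + u₃ + u₄ + u₅ = v₁ + v₂ + v₃)
    (hP2 : (A₁ * u₁ ^ 2 + A₂ * u₂ ^ 2 + A₃ * u₃ ^ 2 + A₄ * u₄ ^ 2 + A₅ * u₅ ^ 2) - (B₁ * v₁ ^ 2 + B₂ * v₂ ^ 2 + B₃ * v₃ ^ 2) = 0)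
    (hP4 : (u₁ ^ 3 + u₂ ^ 3 + u₃ ^ 3 + u₄ ^ 3 + u₅ ^ 3) - (v₁ ^ 3 + v₂ ^ 3 + v₃ ^ 3) = 0)
    (m₁₁ : |u₁ - v₁| ≤ A₁ - B₁) (m₂₁ : |u₂ - v₁| ≤ A₂ - B₁) (m₃₁ : |u₃ - v₁| ≤ A₃ - B₁) (m₄₁ : |u₄ - v₁| ≤ A₄ - B₁) (m₅₁ : |u₅ - v₁| ≤ A₅ - B₁)
    (m₁₂ : |u₁ - v₂| ≤ A₁ - B₂) (m₂₂ : |u₂ - v₂| ≤ A₂ - B₂) (m₃₂ : |u₃ - v₂| ≤ A₃ - B₂) (m₄₂ : |u₄ - v₂| ≤ A₄ - B₂) (m₅₂ : |u₅ - v₂| ≤ A₅ - B₂)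
    (m₁₃ : |u₁ - v₃| ≤ A₁ - B₃) (m₂₃ : |u₂ - v₃| ≤ A₂ - B₃) (m₃₃ : |u₃ - v₃| ≤ A₃ - B₃) (m₄₃ : |u₄ - v₃| ≤ A₄ - B₃) (m₅₃ : |u₅ - v₃| ≤ A₅ - B₃)
    (h₁ : v₁ < u₁) (h₁₂ : u₁ ≤ u₂) (h₂ : u₂ < v₂) (h₂₃ : v₂ ≤ v₃) (h₃ : v₃ < u₃) (h₃₄ : u₃ ≤ u₄) (h₄₅ : u₄ ≤ u₅)
    (hQ4 : 3 * ((u₁ ^ 4 + u₂ ^ 4 + u₃ ^ 4 + u₄ ^ 4 + u₅ ^ 4) - (v₁ ^ 4 + v₂ ^ 4 + v₃ ^ 4)) - (3 / 2) * ((u₁ ^ 2 + u₂ ^ 2 + u₃ ^ 2 + u₄ ^ 2 + u₅ ^ 2) - (v₁ ^ 2 + v₂ ^ 2 + v₃ ^ 2)) ^ 2 < 0)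
    (hρ : 0 ≤ ρ) (hρ2 : ρ ^ 2 = ((u₁ ^ 2 + u₂ ^ 2 + u₃ ^ 2 + u₄ ^ 2 + u₅ ^ 2) - (v₁ ^ 2 + v₂ ^ 2 + v₃ ^ 2)) / 2) :
    u₂ < -ρ ∧ -ρ < u₅ ∧ u₅ < ρ := by
  have hσ : (-((u₁ * u₂ * u₃ * u₄ + u₁ * u₂ * u₃ * u₅ + u₁ * u₂ * u₄ * u₅ + u₁ * u₃ * u₄ * u₅ + u₂ * u₃ * u₄ * u₅) + (v₁ * v₂ + v₁ * v₃ + v₂ * v₃) * ((u₁ ^ 2 + u₂ ^ 2 + u₃ ^ 2 + u₄ ^ 2 + u₅ ^ 2) - (v₁ ^ 2 + v₂ ^ 2 + v₃ ^ 2)) / 2)) < 0 := by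
    have e := Q4_eq_slope u₁ u₂ u₃ u₄ u₅ v₁ v₂ v₃ hC
    rw [hP4] at e
    linarith only [e, hQ4]
  -- ℓ(v₂) = K₀(2) > 0, hence ℓ(u₁), ℓ(u₂) > 0 and the walls of u₁, u₂ are positive
  have k21 : u₁ - v₂ < 0 := by linarith only [h₁, h₁₂, h₂, h₂₃, h₃, h₃₄, h₄₅]
  have k22 : u₂ - v₂ < 0 := by linarith only [h₁, h₁₂, h₂, h₂₃, h₃, h₃₄, h₄₅]
  have k23 : 0 < u₃ - v₂ := by linarith only [h₁, h₁₂, h₂, h₂₃, h₃, h₃₄, h₄₅]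
  have k24 : 0 < u₄ - v₂ := by linarith only [h₁, h₁₂, h₂, h₂₃, h₃, h₃₄, h₄₅]
  have k25 : 0 < u₅ - v₂ := by linarith only [h₁, h₁₂, h₂, h₂₃, h₃, h₃₄, h₄₅]
  have hK2 : 0 < (u₁ - v₂) * (u₂ - v₂) * (u₃ - v₂) * (u₄ - v₂) * (u₅ - v₂) := mul_pos (mul_pos (mul_pos (mul_pos_of_neg_of_neg k21 k22) k23) k24) k25
  have hl2 := K0_eq_line₂ u₁ u₂ u₃ u₄ u₅ v₁ v₂ v₃ hC hP4
  have eu1 : (((u₁ * u₂ * u₃ * u₄ * u₅) + (v₁ * v₂ * v₃) * ((u₁ ^ 2 + u₂ ^ 2 + u₃ ^ 2 + u₄ ^ 2 + u₅ ^ 2) - (v₁ ^ 2 + v₂ ^ 2 + v₃ ^ 2)) / 2) + (-((u₁ * u₂ * u₃ * u₄ + u₁ * u₂ * u₃ * u₅ + u₁ * u₂ * u₄ * u₅ + u₁ * u₃ * u₄ * u₅ + u₂ * u₃ * u₄ * u₅) + (v₁ * v₂ + v₁ * v₃ + v₂ * v₃) * ((u₁ ^ 2 + u₂ ^ 2 +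 u₃ ^ 2 + u₄ ^ 2 + u₅ ^ 2) - (v₁ ^ 2 + v₂ ^ 2 + v₃ ^ 2)) / 2)) * u₁) = (((u₁ * u₂ * u₃ * u₄ * u₅) + (v₁ * v₂ * v₃) * ((u₁ ^ 2 + u₂ ^ 2 + u₃ ^ 2 + u₄ ^ 2 + u₅ ^ 2) - (v₁ ^ 2 + v₂ ^ 2 + v₃ ^ 2)) / 2) + (-((u₁ * u₂ * u₃ * u₄ + u₁ * u₂ * u₃ * u₅ + u₁ * u₂ * u₄ * u₅ + u₁ * u₃ * u₄ * u₅ + u₂ * u₃ * u₄ * u₅) + (v₁ * v₂ + v₁ * v₃ + v₂ * v₃) * ((u₁ ^ 2 + u₂ ^ 2 + u₃ ^ 2 + u₄ ^ 2 + u₅ ^ 2) - (v₁ ^ 2 + v₂ ^ 2 + v₃ ^ 2)) / 2)) * v₂) + (-((u₁ * u₂ * u₃ * u₄ + u₁ * u₂ * u₃ * u₅ + u₁ * u₂ * u₄ * u₅ + u₁ * u₃ * u₄ * u₅ + u₂ * u₃ * u₄ * u₅) + (v₁ * v₂ + v₁ * v₃ + v₂ * v₃) * ((u₁ ^ 2 +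 u₂ ^ 2 + u₃ ^ 2 + u₄ ^ 2 + u₅ ^ 2) - (v₁ ^ 2 + v₂ ^ 2 + v₃ ^ 2)) / 2)) * (u₁ - v₂) := by ring
  have hlu1 : 0 < (((u₁ * u₂ * u₃ * u₄ * u₅) + (v₁ * v₂ * v₃) * ((u₁ ^ 2 + u₂ ^ 2 + u₃ ^ 2 + u₄ ^ 2 + u₅ ^ 2) - (v₁ ^ 2 + v₂ ^ 2 + v₃ ^ 2)) / 2) + (-((u₁ * u₂ * u₃ * u₄ + u₁ * u₂ * u₃ * u₅ + u₁ * u₂ * u₄ * u₅ + u₁ * u₃ * u₄ * u₅ + u₂ * u₃ * u₄ * u₅) + (v₁ * v₂ + v₁ * v₃ + v₂ * v₃) * ((u₁ ^ 2 + u₂ ^ 2 + u₃ ^ 2 + u₄ ^ 2 + u₅ ^ 2) - (v₁ ^ 2 + v₂ ^ 2 + v₃ ^ 2)) / 2)) * u₁) := by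
    rw [eu1, ← hl2]
    have : 0 < (-((u₁ * u₂ * u₃ * u₄ + u₁ * u₂ * u₃ * u₅ + u₁ * u₂ * u₄ * u₅ + u₁ * u₃ * u₄ * u₅ + u₂ * u₃ * u₄ * u₅) + (v₁ * v₂ + v₁ * v₃ + v₂ * v₃) * ((u₁ ^ 2 + u₂ ^ 2 + u₃ ^ 2 + u₄ ^ 2 + u₅ ^ 2) - (v₁ ^ 2 + v₂ ^ 2 + v₃ ^ 2)) / 2)) * (u₁ - v₂) := mul_pos_of_neg_of_neg hσ (by linarith only [h₁, h₁₂, h₂, h₂₃, h₃, h₃₄, h₄₅])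
    linarith only [hK2, this]
  have c11 : 0 < u₁ - v₁ := by linarith only [h₁, h₁₂, h₂, h₂₃, h₃, h₃₄, h₄₅]
  have c12 : u₁ - v₂ < 0 := by linarith only [h₁, h₁₂, h₂, h₂₃, h₃, h₃₄, h₄₅]
  have c13 : u₁ - v₃ < 0 := by linarith only [h₁, h₁₂, h₂, h₂₃, h₃, h₃₄, h₄₅]
  have hC1 : 0 < ((u₁ - v₁) * (u₁ - v₂) * (u₁ - v₃)) := mul_pos_of_neg_of_neg (mul_neg_of_pos_of_neg c11 c12) c13
  have hq1 := wall_eq_line₁ u₁ u₂ u₃ u₄ u₅ v₁ v₂ v₃ hC hP4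
  have hw1 : 0 < (u₁ ^ 2 - ((u₁ ^ 2 + u₂ ^ 2 + u₃ ^ 2 + u₄ ^ 2 + u₅ ^ 2) - (v₁ ^ 2 + v₂ ^ 2 + v₃ ^ 2)) / 2) := by
    have h : 0 < (u₁ ^ 2 - ((u₁ ^ 2 + u₂ ^ 2 + u₃ ^ 2 + u₄ ^ 2 + u₅ ^ 2) - (v₁ ^ 2 + v₂ ^ 2 + v₃ ^ 2)) / 2) * ((u₁ - v₁) * (u₁ - v₂) * (u₁ - v₃)) := by rw [hq1]; exact hlu1
    exact pos_of_mul_pos_of_pos_right _ _ h hC1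
  have eu2 : (((u₁ * u₂ * u₃ * u₄ * u₅) + (v₁ * v₂ * v₃) * ((u₁ ^ 2 + u₂ ^ 2 + u₃ ^ 2 + u₄ ^ 2 + u₅ ^ 2) - (v₁ ^ 2 + v₂ ^ 2 + v₃ ^ 2)) / 2) + (-((u₁ * u₂ * u₃ * u₄ + u₁ * u₂ * u₃ * u₅ + u₁ * u₂ * u₄ * u₅ + u₁ * u₃ * u₄ * u₅ + u₂ * u₃ * u₄ * u₅) + (v₁ * v₂ + v₁ * v₃ + v₂ * v₃) * ((u₁ ^ 2 + u₂ ^ 2 + u₃ ^ 2 + u₄ ^ 2 + u₅ ^ 2) - (v₁ ^ 2 + v₂ ^ 2 + v₃ ^ 2)) / 2)) * u₂) = (((u₁ * u₂ * u₃ * u₄ * u₅) + (v₁ * v₂ * v₃) * ((u₁ ^ 2 + u₂ ^ 2 + u₃ ^ 2 + u₄ ^ 2 + u₅ ^ 2) - (v₁ ^ 2 + v₂ ^ 2 + v₃ ^ 2)) / 2) + (-((u₁ * u₂ * u₃ * u₄ + u₁ * u₂ * u₃ * u₅ + u₁ * u₂ * u₄ * u₅ + u₁ * u₃ * u₄ *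 u₅ + u₂ * u₃ * u₄ * u₅) + (v₁ * v₂ + v₁ * v₃ + v₂ * v₃) * ((u₁ ^ 2 + u₂ ^ 2 + u₃ ^ 2 + u₄ ^ 2 + u₅ ^ 2) - (v₁ ^ 2 + v₂ ^ 2 + v₃ ^ 2)) / 2)) * v₂) + (-((u₁ * u₂ * u₃ * u₄ + u₁ * u₂ * u₃ * u₅ + u₁ * u₂ * u₄ * u₅ + u₁ * u₃ * u₄ * u₅ + u₂ * u₃ * u₄ * u₅) + (v₁ * v₂ + v₁ * v₃ + v₂ * v₃) * ((u₁ ^ 2 + u₂ ^ 2 + u₃ ^ 2 + u₄ ^ 2 + u₅ ^ 2) - (v₁ ^ 2 + v₂ ^ 2 + v₃ ^ 2)) / 2)) * (u₂ - v₂) := by ring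
  have hlu2 : 0 < (((u₁ * u₂ * u₃ * u₄ * u₅) + (v₁ * v₂ * v₃) * ((u₁ ^ 2 + u₂ ^ 2 + u₃ ^ 2 + u₄ ^ 2 + u₅ ^ 2) - (v₁ ^ 2 + v₂ ^ 2 + v₃ ^ 2)) / 2) + (-((u₁ * u₂ * u₃ * u₄ + u₁ * u₂ * u₃ * u₅ + u₁ * u₂ * u₄ * u₅ + u₁ * u₃ * u₄ * u₅ + u₂ * u₃ * u₄ * u₅) + (v₁ * v₂ + v₁ * v₃ + v₂ * v₃) * ((u₁ ^ 2 + u₂ ^ 2 + u₃ ^ 2 + u₄ ^ 2 + u₅ ^ 2) - (v₁ ^ 2 + v₂ ^ 2 + v₃ ^ 2)) / 2)) * u₂) := by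
    rw [eu2, ← hl2]
    have : 0 < (-((u₁ * u₂ * u₃ * u₄ + u₁ * u₂ * u₃ * u₅ + u₁ * u₂ * u₄ * u₅ + u₁ * u₃ * u₄ * u₅ + u₂ * u₃ * u₄ * u₅) + (v₁ * v₂ + v₁ * v₃ + v₂ * v₃) * ((u₁ ^ 2 + u₂ ^ 2 + u₃ ^ 2 + u₄ ^ 2 + u₅ ^ 2) - (v₁ ^ 2 + v₂ ^ 2 + v₃ ^ 2)) / 2)) * (u₂ - v₂) := mul_pos_of_neg_of_neg hσ (by linarith only [h₁, h₁₂, h₂, h₂₃, h₃, h₃₄, h₄₅])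
    linarith only [hK2, this]
  have c21 : 0 < u₂ - v₁ := by linarith only [h₁, h₁₂, h₂, h₂₃, h₃, h₃₄, h₄₅]
  have c22 : u₂ - v₂ < 0 := by linarith only [h₁, h₁₂, h₂, h₂₃, h₃, h₃₄, h₄₅]
  have c23 : u₂ - v₃ < 0 := by linarith only [h₁, h₁₂, h₂, h₂₃, h₃, h₃₄, h₄₅]
  have hC2 : 0 < ((u₂ - v₁) * (u₂ - v₂) * (u₂ - v₃)) := mul_pos_of_neg_of_neg (mul_neg_of_pos_of_neg c21 c22) c23
  have hq2 := wall_eq_line₂ u₁ u₂ u₃ u₄ u₅ v₁ v₂ v₃ hC hP4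
  have hw2 : 0 < (u₂ ^ 2 - ((u₁ ^ 2 + u₂ ^ 2 + u₃ ^ 2 + u₄ ^ 2 + u₅ ^ 2) - (v₁ ^ 2 + v₂ ^ 2 + v₃ ^ 2)) / 2) := by
    have h : 0 < (u₂ ^ 2 - ((u₁ ^ 2 + u₂ ^ 2 + u₃ ^ 2 + u₄ ^ 2 + u₅ ^ 2) - (v₁ ^ 2 + v₂ ^ 2 + v₃ ^ 2)) / 2) * ((u₂ - v₁) * (u₂ - v₂) * (u₂ - v₃)) := by rw [hq2]; exact hlu2
    exact pos_of_mul_pos_of_pos_right _ _ h hC2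
  have c31 : 0 < u₃ - v₁ := by linarith only [h₁, h₁₂, h₂, h₂₃, h₃, h₃₄, h₄₅]
  have c32 : 0 < u₃ - v₂ := by linarith only [h₁, h₁₂, h₂, h₂₃, h₃, h₃₄, h₄₅]
  have c33 : 0 < u₃ - v₃ := by linarith only [h₁, h₁₂, h₂, h₂₃, h₃, h₃₄, h₄₅]
  have hC3 : 0 < ((u₃ - v₁) * (u₃ - v₂) * (u₃ - v₃)) := mul_pos (mul_pos c31 c32) c33
  have hq3 := wall_eq_line₃ u₁ u₂ u₃ u₄ u₅ v₁ v₂ v₃ hC hP4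
  have c41 : 0 < u₄ - v₁ := by linarith only [h₁, h₁₂, h₂, h₂₃, h₃, h₃₄, h₄₅]
  have c42 : 0 < u₄ - v₂ := by linarith only [h₁, h₁₂, h₂, h₂₃, h₃, h₃₄, h₄₅]
  have c43 : 0 < u₄ - v₃ := by linarith only [h₁, h₁₂, h₂, h₂₃, h₃, h₃₄, h₄₅]
  have hC4 : 0 < ((u₄ - v₁) * (u₄ - v₂) * (u₄ - v₃)) := mul_pos (mul_pos c41 c42) c43
  have hq4 := wall_eq_line₄ u₁ u₂ u₃ u₄ u₅ v₁ v₂ v₃ hC hP4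
  have c51 : 0 < u₅ - v₁ := by linarith only [h₁, h₁₂, h₂, h₂₃, h₃, h₃₄, h₄₅]
  have c52 : 0 < u₅ - v₂ := by linarith only [h₁, h₁₂, h₂, h₂₃, h₃, h₃₄, h₄₅]
  have c53 : 0 < u₅ - v₃ := by linarith only [h₁, h₁₂, h₂, h₂₃, h₃, h₃₄, h₄₅]
  have hC5 : 0 < ((u₅ - v₁) * (u₅ - v₂) * (u₅ - v₃)) := mul_pos (mul_pos c51 c52) c53
  have hq5 := wall_eq_line₅ u₁ u₂ u₃ u₄ u₅ v₁ v₂ v₃ hC hP4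
  -- main claim: ℓ(u₅) < 0
  have hlu5 : (((u₁ * u₂ * u₃ * u₄ * u₅) + (v₁ * v₂ * v₃) * ((u₁ ^ 2 + u₂ ^ 2 + u₃ ^ 2 + u₄ ^ 2 + u₅ ^ 2) - (v₁ ^ 2 + v₂ ^ 2 + v₃ ^ 2)) / 2) + (-((u₁ * u₂ * u₃ * u₄ + u₁ * u₂ * u₃ * u₅ + u₁ * u₂ * u₄ * u₅ + u₁ * u₃ * u₄ * u₅ + u₂ * u₃ * u₄ * u₅) + (v₁ * v₂ + v₁ * v₃ + v₂ * v₃) * ((u₁ ^ 2 + u₂ ^ 2 + u₃ ^ 2 + u₄ ^ 2 + u₅ ^ 2) - (v₁ ^ 2 + v₂ ^ 2 + v₃ ^ 2)) / 2)) * u₅) < 0 := by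
    by_contra hcon
    have h5 : 0 ≤ (((u₁ * u₂ * u₃ * u₄ * u₅) + (v₁ * v₂ * v₃) * ((u₁ ^ 2 + u₂ ^ 2 + u₃ ^ 2 + u₄ ^ 2 + u₅ ^ 2) - (v₁ ^ 2 + v₂ ^ 2 + v₃ ^ 2)) / 2) + (-((u₁ * u₂ * u₃ * u₄ + u₁ * u₂ * u₃ * u₅ + u₁ * u₂ * u₄ * u₅ + u₁ * u₃ * u₄ * u₅ + u₂ * u₃ * u₄ * u₅) + (v₁ * v₂ + v₁ * v₃ + v₂ * v₃) * ((u₁ ^ 2 + u₂ ^ 2 + u₃ ^ 2 + u₄ ^ 2 + u₅ ^ 2) - (v₁ ^ 2 + v₂ ^ 2 + v₃ ^ 2)) / 2)) * u₅) := not_lt.mp hcon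
    have f3 : (((u₁ * u₂ * u₃ * u₄ * u₅) + (v₁ * v₂ * v₃) * ((u₁ ^ 2 + u₂ ^ 2 + u₃ ^ 2 + u₄ ^ 2 + u₅ ^ 2) - (v₁ ^ 2 + v₂ ^ 2 + v₃ ^ 2)) / 2) + (-((u₁ * u₂ * u₃ * u₄ + u₁ * u₂ * u₃ * u₅ + u₁ * u₂ * u₄ * u₅ + u₁ * u₃ * u₄ * u₅ + u₂ * u₃ * u₄ * u₅) + (v₁ * v₂ + v₁ * v₃ + v₂ * v₃) * ((u₁ ^ 2 + u₂ ^ 2 + u₃ ^ 2 + u₄ ^ 2 + u₅ ^ 2) - (v₁ ^ 2 + v₂ ^ 2 + v₃ ^ 2)) / 2)) * u₃) = (((u₁ * u₂ * u₃ * u₄ * u₅) + (v₁ * v₂ * v₃) * ((u₁ ^ 2 + u₂ ^ 2 + u₃ ^ 2 + u₄ ^ 2 + u₅ ^ 2) - (v₁ ^ 2 + v₂ ^ 2 + v₃ ^ 2)) / 2) + (-((u₁ * u₂ * u₃ * u₄ + u₁ * u₂ * u₃ * u₅ + u₁ * u₂ * u₄ * u₅ + u₁ * u₃ * u₄ * u₅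 + u₂ * u₃ * u₄ * u₅) + (v₁ * v₂ + v₁ * v₃ + v₂ * v₃) * ((u₁ ^ 2 + u₂ ^ 2 + u₃ ^ 2 + u₄ ^ 2 + u₅ ^ 2) - (v₁ ^ 2 + v₂ ^ 2 + v₃ ^ 2)) / 2)) * u₅) + (-((u₁ * u₂ * u₃ * u₄ + u₁ * u₂ * u₃ * u₅ + u₁ * u₂ * u₄ * u₅ + u₁ * u₃ * u₄ * u₅ + u₂ * u₃ * u₄ * u₅) + (v₁ * v₂ + v₁ * v₃ + v₂ * v₃) * ((u₁ ^ 2 + u₂ ^ 2 + u₃ ^ 2 + u₄ ^ 2 + u₅ ^ 2) - (v₁ ^ 2 + v₂ ^ 2 + v₃ ^ 2)) / 2)) * (u₃ - u₅) := by ring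
    have g3 : 0 ≤ (((u₁ * u₂ * u₃ * u₄ * u₅) + (v₁ * v₂ * v₃) * ((u₁ ^ 2 + u₂ ^ 2 + u₃ ^ 2 + u₄ ^ 2 + u₅ ^ 2) - (v₁ ^ 2 + v₂ ^ 2 + v₃ ^ 2)) / 2) + (-((u₁ * u₂ * u₃ * u₄ + u₁ * u₂ * u₃ * u₅ + u₁ * u₂ * u₄ * u₅ + u₁ * u₃ * u₄ * u₅ + u₂ * u₃ * u₄ * u₅) + (v₁ * v₂ + v₁ * v₃ + v₂ * v₃) * ((u₁ ^ 2 + u₂ ^ 2 + u₃ ^ 2 + u₄ ^ 2 + u₅ ^ 2) - (v₁ ^ 2 + v₂ ^ 2 + v₃ ^ 2)) / 2)) * u₃) := by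
      rw [f3]
      have : 0 ≤ (-((u₁ * u₂ * u₃ * u₄ + u₁ * u₂ * u₃ * u₅ + u₁ * u₂ * u₄ * u₅ + u₁ * u₃ * u₄ * u₅ + u₂ * u₃ * u₄ * u₅) + (v₁ * v₂ + v₁ * v₃ + v₂ * v₃) * ((u₁ ^ 2 + u₂ ^ 2 + u₃ ^ 2 + u₄ ^ 2 + u₅ ^ 2) - (v₁ ^ 2 + v₂ ^ 2 + v₃ ^ 2)) / 2)) * (u₃ - u₅) := mul_nonneg_of_nonpos_nonpos _ _ (le_of_lt hσ) (by linarith only [h₁, h₁₂, h₂, h₂₃, h₃, h₃₄, h₄₅])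
      linarith only [h5, this]
    have f4 : (((u₁ * u₂ * u₃ * u₄ * u₅) + (v₁ * v₂ * v₃) * ((u₁ ^ 2 + u₂ ^ 2 + u₃ ^ 2 + u₄ ^ 2 + u₅ ^ 2) - (v₁ ^ 2 + v₂ ^ 2 + v₃ ^ 2)) / 2) + (-((u₁ * u₂ * u₃ * u₄ + u₁ * u₂ * u₃ * u₅ + u₁ * u₂ * u₄ * u₅ + u₁ * u₃ * u₄ * u₅ + u₂ * u₃ * u₄ * u₅) + (v₁ * v₂ + v₁ * v₃ + v₂ * v₃) * ((u₁ ^ 2 + u₂ ^ 2 + u₃ ^ 2 + u₄ ^ 2 + u₅ ^ 2) - (v₁ ^ 2 + v₂ ^ 2 + v₃ ^ 2)) / 2)) * u₄) = (((u₁ * u₂ * u₃ * u₄ * u₅) + (v₁ * v₂ * v₃) * ((u₁ ^ 2 + u₂ ^ 2 + u₃ ^ 2 + u₄ ^ 2 + u₅ ^ 2) - (v₁ ^ 2 + v₂ ^ 2 + v₃ ^ 2)) / 2) + (-((u₁ * u₂ * u₃ * u₄ + u₁ * u₂ * u₃ * u₅ + u₁ * u₂ * u₄ * u₅ + u₁ *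 u₃ * u₄ * u₅ + u₂ * u₃ * u₄ * u₅) + (v₁ * v₂ + v₁ * v₃ + v₂ * v₃) * ((u₁ ^ 2 + u₂ ^ 2 + u₃ ^ 2 + u₄ ^ 2 + u₅ ^ 2) - (v₁ ^ 2 + v₂ ^ 2 + v₃ ^ 2)) / 2)) * u₅) + (-((u₁ * u₂ * u₃ * u₄ + u₁ * u₂ * u₃ * u₅ + u₁ * u₂ * u₄ * u₅ + u₁ * u₃ * u₄ * u₅ + u₂ * u₃ * u₄ * u₅) + (v₁ * v₂ + v₁ * v₃ + v₂ * v₃) * ((u₁ ^ 2 + u₂ ^ 2 + u₃ ^ 2 + u₄ ^ 2 + u₅ ^ 2) - (v₁ ^ 2 + v₂ ^ 2 + v₃ ^ 2)) / 2)) * (u₄ - u₅) := by ring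
    have g4 : 0 ≤ (((u₁ * u₂ * u₃ * u₄ * u₅) + (v₁ * v₂ * v₃) * ((u₁ ^ 2 + u₂ ^ 2 + u₃ ^ 2 + u₄ ^ 2 + u₅ ^ 2) - (v₁ ^ 2 + v₂ ^ 2 + v₃ ^ 2)) / 2) + (-((u₁ * u₂ * u₃ * u₄ + u₁ * u₂ * u₃ * u₅ + u₁ * u₂ * u₄ * u₅ + u₁ * u₃ * u₄ * u₅ + u₂ * u₃ * u₄ * u₅) + (v₁ * v₂ + v₁ * v₃ + v₂ * v₃) * ((u₁ ^ 2 + u₂ ^ 2 + u₃ ^ 2 + u₄ ^ 2 + u₅ ^ 2) - (v₁ ^ 2 + v₂ ^ 2 + v₃ ^ 2)) / 2)) * u₄) := by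
      rw [f4]
      have : 0 ≤ (-((u₁ * u₂ * u₃ * u₄ + u₁ * u₂ * u₃ * u₅ + u₁ * u₂ * u₄ * u₅ + u₁ * u₃ * u₄ * u₅ + u₂ * u₃ * u₄ * u₅) + (v₁ * v₂ + v₁ * v₃ + v₂ * v₃) * ((u₁ ^ 2 + u₂ ^ 2 + u₃ ^ 2 + u₄ ^ 2 + u₅ ^ 2) - (v₁ ^ 2 + v₂ ^ 2 + v₃ ^ 2)) / 2)) * (u₄ - u₅) := mul_nonneg_of_nonpos_nonpos _ _ (le_of_lt hσ) (by linarith only [h₁, h₁₂, h₂, h₂₃, h₃, h₃₄, h₄₅])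
      linarith only [h5, this]
    have g5 : 0 ≤ (((u₁ * u₂ * u₃ * u₄ * u₅) + (v₁ * v₂ * v₃) * ((u₁ ^ 2 + u₂ ^ 2 + u₃ ^ 2 + u₄ ^ 2 + u₅ ^ 2) - (v₁ ^ 2 + v₂ ^ 2 + v₃ ^ 2)) / 2) + (-((u₁ * u₂ * u₃ * u₄ + u₁ * u₂ * u₃ * u₅ + u₁ * u₂ * u₄ * u₅ + u₁ * u₃ * u₄ * u₅ + u₂ * u₃ * u₄ * u₅) + (v₁ * v₂ + v₁ * v₃ + v₂ * v₃) * ((u₁ ^ 2 + u₂ ^ 2 + u₃ ^ 2 + u₄ ^ 2 + u₅ ^ 2) - (v₁ ^ 2 + v₂ ^ 2 + v₃ ^ 2)) / 2)) * u₅) := h5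
    have hw3 : 0 ≤ (u₃ ^ 2 - ((u₁ ^ 2 + u₂ ^ 2 + u₃ ^ 2 + u₄ ^ 2 + u₅ ^ 2) - (v₁ ^ 2 + v₂ ^ 2 + v₃ ^ 2)) / 2) := by
      have h : 0 ≤ (u₃ ^ 2 - ((u₁ ^ 2 + u₂ ^ 2 + u₃ ^ 2 + u₄ ^ 2 + u₅ ^ 2) - (v₁ ^ 2 + v₂ ^ 2 + v₃ ^ 2)) / 2) * ((u₃ - v₁) * (u₃ - v₂) * (u₃ - v₃)) := by rw [hq3]; exact g3
      exact nonneg_of_mul_nonneg_of_pos _ _ h hC3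
    have hw4 : 0 ≤ (u₄ ^ 2 - ((u₁ ^ 2 + u₂ ^ 2 + u₃ ^ 2 + u₄ ^ 2 + u₅ ^ 2) - (v₁ ^ 2 + v₂ ^ 2 + v₃ ^ 2)) / 2) := by
      have h : 0 ≤ (u₄ ^ 2 - ((u₁ ^ 2 + u₂ ^ 2 + u₃ ^ 2 + u₄ ^ 2 + u₅ ^ 2) - (v₁ ^ 2 + v₂ ^ 2 + v₃ ^ 2)) / 2) * ((u₄ - v₁) * (u₄ - v₂) * (u₄ - v₃)) := by rw [hq4]; exact g4
      exact nonneg_of_mul_nonneg_of_pos _ _ h hC4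
    have hw5 : 0 ≤ (u₅ ^ 2 - ((u₁ ^ 2 + u₂ ^ 2 + u₃ ^ 2 + u₄ ^ 2 + u₅ ^ 2) - (v₁ ^ 2 + v₂ ^ 2 + v₃ ^ 2)) / 2) := by
      have h : 0 ≤ (u₅ ^ 2 - ((u₁ ^ 2 + u₂ ^ 2 + u₃ ^ 2 + u₄ ^ 2 + u₅ ^ 2) - (v₁ ^ 2 + v₂ ^ 2 + v₃ ^ 2)) / 2) * ((u₅ - v₁) * (u₅ - v₂) * (u₅ - v₃)) := by rw [hq5]; exact g5
      exact nonneg_of_mul_nonneg_of_pos _ _ h hC5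
    have hne : v₁ ≠ u₁ := ne_of_lt h₁
    -- u₁, u₂ outside [−ρ, ρ] strictly; u₃, u₄, u₅ outside (−ρ, ρ)
    have o3 := outside_of_wall_nonneg u₃ ρ ((u₁ ^ 2 + u₂ ^ 2 + u₃ ^ 2 + u₄ ^ 2 + u₅ ^ 2) - (v₁ ^ 2 + v₂ ^ 2 + v₃ ^ 2)) hρ2 hw3
    have o5 := outside_of_wall_nonneg u₅ ρ ((u₁ ^ 2 + u₂ ^ 2 + u₃ ^ 2 + u₄ ^ 2 + u₅ ^ 2) - (v₁ ^ 2 + v₂ ^ 2 + v₃ ^ 2)) hρ2 hw5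
    rcases o5 with h5n | h5p
    · -- (i) u₅ ≤ −ρ: every charge ≤ −ρ, all F-walls positive: wall lemma
      have z1 : 0 < (v₁ ^ 2 - ((u₁ ^ 2 + u₂ ^ 2 + u₃ ^ 2 + u₄ ^ 2 + u₅ ^ 2) - (v₁ ^ 2 + v₂ ^ 2 + v₃ ^ 2)) / 2) := wall_pos_of_lt_neg v₁ ρ ((u₁ ^ 2 + u₂ ^ 2 + u₃ ^ 2 + u₄ ^ 2 + u₅ ^ 2) - (v₁ ^ 2 + v₂ ^ 2 + v₃ ^ 2)) hρ hρ2 (by linarith only [h₁, h₁₂, h₂, h₂₃, h₃, h₃₄, h₄₅, h5n])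
      have z2 : 0 < (v₂ ^ 2 - ((u₁ ^ 2 + u₂ ^ 2 + u₃ ^ 2 + u₄ ^ 2 + u₅ ^ 2) - (v₁ ^ 2 + v₂ ^ 2 + v₃ ^ 2)) / 2) := wall_pos_of_lt_neg v₂ ρ ((u₁ ^ 2 + u₂ ^ 2 + u₃ ^ 2 + u₄ ^ 2 + u₅ ^ 2) - (v₁ ^ 2 + v₂ ^ 2 + v₃ ^ 2)) hρ hρ2 (by linarith only [h₁, h₁₂, h₂, h₂₃, h₃, h₃₄, h₄₅, h5n])
      have z3 : 0 < (v₃ ^ 2 - ((u₁ ^ 2 + u₂ ^ 2 + u₃ ^ 2 + u₄ ^ 2 + u₅ ^ 2) - (v₁ ^ 2 + v₂ ^ 2 + v₃ ^ 2)) / 2) := wall_pos_of_lt_neg v₃ ρ ((u₁ ^ 2 + u₂ ^ 2 + u₃ ^ 2 + u₄ ^ 2 + u₅ ^ 2) - (v₁ ^ 2 + v₂ ^ 2 + v₃ ^ 2)) hρ hρ2 (by linarith only [h₁, h₁₂, h₂, h₂₃, h₃, h₃₄, h₄₅, h5n])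
      exact no_config_of_walls_nonneg A₁ A₂ A₃ A₄ A₅ B₁ B₂ B₃ u₁ u₂ u₃ u₄ u₅ v₁ v₂ v₃ hA hP2 m₁₁ m₂₁ m₃₁ m₄₁ m₅₁ m₁₂ m₂₂ m₃₂ m₄₂ m₅₂ m₁₃ m₂₃ m₃₃ m₄₃ m₅₃ hne hw1 (le_of_lt hw2) hw3 hw4 hw5 z1 z2 z3
    · -- (ii) ρ ≤ u₅
      rcases o3 with h3n | h3p
      · -- (ii-b) u₃ ≤ −ρ: the F-charges are below −ρ: wall lemma again
        have z1 : 0 < (v₁ ^ 2 - ((u₁ ^ 2 + u₂ ^ 2 + u₃ ^ 2 + u₄ ^ 2 + u₅ ^ 2) - (v₁ ^ 2 + v₂ ^ 2 + v₃ ^ 2)) / 2) := wall_pos_of_lt_neg v₁ ρ ((u₁ ^ 2 + u₂ ^ 2 + u₃ ^ 2 + u₄ ^ 2 + u₅ ^ 2) - (v₁ ^ 2 + v₂ ^ 2 + v₃ ^ 2)) hρ hρ2 (by linarith only [h₁, h₁₂, h₂, h₂₃, h₃, h₃₄, h₄₅, h3n])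
        have z2 : 0 < (v₂ ^ 2 - ((u₁ ^ 2 + u₂ ^ 2 + u₃ ^ 2 + u₄ ^ 2 + u₅ ^ 2) - (v₁ ^ 2 + v₂ ^ 2 + v₃ ^ 2)) / 2) := wall_pos_of_lt_neg v₂ ρ ((u₁ ^ 2 + u₂ ^ 2 + u₃ ^ 2 + u₄ ^ 2 + u₅ ^ 2) - (v₁ ^ 2 + v₂ ^ 2 + v₃ ^ 2)) hρ hρ2 (by linarith only [h₁, h₁₂, h₂, h₂₃, h₃, h₃₄, h₄₅, h3n])
        have z3 : 0 < (v₃ ^ 2 - ((u₁ ^ 2 + u₂ ^ 2 + u₃ ^ 2 + u₄ ^ 2 + u₅ ^ 2) - (v₁ ^ 2 + v₂ ^ 2 + v₃ ^ 2)) / 2) := wall_pos_of_lt_neg v₃ ρ ((u₁ ^ 2 + u₂ ^ 2 + u₃ ^ 2 + u₄ ^ 2 + u₅ ^ 2) - (v₁ ^ 2 + v₂ ^ 2 + v₃ ^ 2)) hρ hρ2 (by linarith only [h₁, h₁₂, h₂, h₂₃, h₃, h₃₄, h₄₅, h3n])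
        exact no_config_of_walls_nonneg A₁ A₂ A₃ A₄ A₅ B₁ B₂ B₃ u₁ u₂ u₃ u₄ u₅ v₁ v₂ v₃ hA hP2 m₁₁ m₂₁ m₃₁ m₄₁ m₅₁ m₁₂ m₂₂ m₃₂ m₄₂ m₅₂ m₁₃ m₂₃ m₃₃ m₄₃ m₅₃ hne hw1 (le_of_lt hw2) hw3 hw4 hw5 z1 z2 z3
      · -- (ii-a) ρ ≤ u₃; where is u₂?  (its wall is positive: u₂ < −ρ or ρ < u₂)
        rcases lt_or_ge u₂ (-ρ) with h2n | h2p'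
        · -- (ii-a-2) u₂ < −ρ ≤ ρ ≤ u₃: three sign changes — cubic test with roots u₁, u₂, u₃
          have ct := cubic_test u₁ u₂ u₃ u₄ u₅ v₁ v₂ v₃ ρ u₁ u₂ u₃ hC hP4 hρ2
          have su1 : ((u₁ - u₁) * (u₁ - u₂) * (u₁ - u₃)) = 0 := by ring
          have su2 : ((u₂ - u₁) * (u₂ - u₂) * (u₂ - u₃)) = 0 := by ring
          have su3 : ((u₃ - u₁) * (u₃ - u₂) * (u₃ - u₃)) = 0 := by ring
          have su4 : 0 ≤ ((u₄ - u₁) * (u₄ - u₂) * (u₄ - u₃)) := by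
            have a1 : 0 ≤ u₄ - u₁ := by linarith only [h₁, h₁₂, h₂, h₂₃, h₃, h₃₄, h₄₅]
            have a2 : 0 ≤ u₄ - u₂ := by linarith only [h₁, h₁₂, h₂, h₂₃, h₃, h₃₄, h₄₅]
            have a3 : 0 ≤ u₄ - u₃ := by linarith only [h₁, h₁₂, h₂, h₂₃, h₃, h₃₄, h₄₅]
            positivity
          have su5 : 0 ≤ ((u₅ - u₁) * (u₅ - u₂) * (u₅ - u₃)) := by
            have a1 : 0 ≤ u₅ - u₁ := by linarith only [h₁, h₁₂, h₂, h₂₃, h₃, h₃₄, h₄₅]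
            have a2 : 0 ≤ u₅ - u₂ := by linarith only [h₁, h₁₂, h₂, h₂₃, h₃, h₃₄, h₄₅]
            have a3 : 0 ≤ u₅ - u₃ := by linarith only [h₁, h₁₂, h₂, h₂₃, h₃, h₃₄, h₄₅]
            positivity
          have sv1 : ((v₁ - u₁) * (v₁ - u₂) * (v₁ - u₃)) < 0 := prod3_neg_nnn _ _ _ (by linarith only [h₁, h₁₂, h₂, h₂₃, h₃, h₃₄, h₄₅]) (by linarith only [h₁, h₁₂, h₂, h₂₃, h₃, h₃₄, h₄₅]) (by linarith only [h₁, h₁₂, h₂, h₂₃, h₃, h₃₄, h₄₅])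
          have sv2 : ((v₂ - u₁) * (v₂ - u₂) * (v₂ - u₃)) ≤ 0 := prod3_nonpos_ppn _ _ _ (by linarith only [h₁, h₁₂, h₂, h₂₃, h₃, h₃₄, h₄₅]) (by linarith only [h₁, h₁₂, h₂, h₂₃, h₃, h₃₄, h₄₅]) (by linarith only [h₁, h₁₂, h₂, h₂₃, h₃, h₃₄, h₄₅])
          have sv3 : ((v₃ - u₁) * (v₃ - u₂) * (v₃ - u₃)) ≤ 0 := prod3_nonpos_ppn _ _ _ (by linarith only [h₁, h₁₂, h₂, h₂₃, h₃, h₃₄, h₄₅]) (by linarith only [h₁, h₁₂, h₂, h₂₃, h₃, h₃₄, h₄₅]) (by linarith only [h₁, h₁₂, h₂, h₂₃, h₃, h₃₄, h₄₅])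
          have sr : ((ρ - u₁) * (ρ - u₂) * (ρ - u₃)) ≤ 0 := prod3_nonpos_ppn _ _ _ (by linarith only [h₁, h₁₂, h₂, h₂₃, h₃, h₃₄, h₄₅, h2n, hρ]) (by linarith only [h2n, hρ]) (by linarith only [h3p])
          have sm : (((-ρ) - u₁) * ((-ρ) - u₂) * ((-ρ) - u₃)) ≤ 0 := prod3_nonpos_ppn _ _ _ (by linarith only [h₁, h₁₂, h₂, h₂₃, h₃, h₃₄, h₄₅, h2n]) (by linarith only [h2n]) (by linarith only [h3p, hρ])
          linarith only [ct, su1, su2, su3, su4, su5, sv1, sv2, sv3, sr, sm]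
        · have h2p : ρ < u₂ := gt_of_wall_pos u₂ ρ ((u₁ ^ 2 + u₂ ^ 2 + u₃ ^ 2 + u₄ ^ 2 + u₅ ^ 2) - (v₁ ^ 2 + v₂ ^ 2 + v₃ ^ 2)) hρ2 hw2 (ge_iff_le.mp h2p')
          -- (ii-a-1) ρ < u₂ (< v₂ ≤ v₃ < u₃): where is u₁?
          rcases lt_or_ge u₁ (-ρ) with h1n | h1p'
          · -- u₁ < −ρ ≤ ρ < u₂: all eight walls positive — wall lemma
            have z1 : 0 < (v₁ ^ 2 - ((u₁ ^ 2 + u₂ ^ 2 + u₃ ^ 2 + u₄ ^ 2 + u₅ ^ 2) - (v₁ ^ 2 + v₂ ^ 2 + v₃ ^ 2)) / 2) := wall_pos_of_lt_neg v₁ ρ ((u₁ ^ 2 + u₂ ^ 2 + u₃ ^ 2 + u₄ ^ 2 + u₅ ^ 2) - (v₁ ^ 2 + v₂ ^ 2 + v₃ ^ 2)) hρ hρ2 (by linarith only [h₁, h₁₂, h₂, h₂₃, h₃, h₃₄, h₄₅, h1n])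
            have z2 : 0 < (v₂ ^ 2 - ((u₁ ^ 2 + u₂ ^ 2 + u₃ ^ 2 + u₄ ^ 2 + u₅ ^ 2) - (v₁ ^ 2 + v₂ ^ 2 + v₃ ^ 2)) / 2) := wall_pos_of_gt v₂ ρ ((u₁ ^ 2 + u₂ ^ 2 + u₃ ^ 2 + u₄ ^ 2 + u₅ ^ 2) - (v₁ ^ 2 + v₂ ^ 2 + v₃ ^ 2)) hρ hρ2 (by linarith only [h₁, h₁₂, h₂, h₂₃, h₃, h₃₄, h₄₅, h2p])
            have z3 : 0 < (v₃ ^ 2 - ((u₁ ^ 2 + u₂ ^ 2 + u₃ ^ 2 + u₄ ^ 2 + u₅ ^ 2) - (v₁ ^ 2 + v₂ ^ 2 + v₃ ^ 2)) / 2) := wall_pos_of_gt v₃ ρ ((u₁ ^ 2 + u₂ ^ 2 + u₃ ^ 2 + u₄ ^ 2 + u₅ ^ 2) - (v₁ ^ 2 + v₂ ^ 2 + v₃ ^ 2)) hρ hρ2 (by linarith only [h₁, h₁₂, h₂, h₂₃, h₃, h₃₄, h₄₅, h2p])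
            exact no_config_of_walls_nonneg A₁ A₂ A₃ A₄ A₅ B₁ B₂ B₃ u₁ u₂ u₃ u₄ u₅ v₁ v₂ v₃ hA hP2 m₁₁ m₂₁ m₃₁ m₄₁ m₅₁ m₁₂ m₂₂ m₃₂ m₄₂ m₅₂ m₁₃ m₂₃ m₃₃ m₄₃ m₅₃ hne hw1 (le_of_lt hw2) hw3 hw4 hw5 z1 z2 z3
          · have h1p : ρ < u₁ := gt_of_wall_pos u₁ ρ ((u₁ ^ 2 + u₂ ^ 2 + u₃ ^ 2 + u₄ ^ 2 + u₅ ^ 2) - (v₁ ^ 2 + v₂ ^ 2 + v₃ ^ 2)) hρ2 hw1 (ge_iff_le.mp h1p')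
            -- v₁, −ρ, ρ < u₁ ≤ u₂ < v₂ ≤ v₃ < u₃: three sign changes — cubic test with roots u₁, v₂, u₃
            have ct := cubic_test u₁ u₂ u₃ u₄ u₅ v₁ v₂ v₃ ρ u₁ v₂ u₃ hC hP4 hρ2
            have su1 : ((u₁ - u₁) * (u₁ - v₂) * (u₁ - u₃)) = 0 := by ring
            have su2 : 0 ≤ ((u₂ - u₁) * (u₂ - v₂) * (u₂ - u₃)) := prod3_nonneg_pnn _ _ _ (by linarith only [h₁, h₁₂, h₂, h₂₃, h₃, h₃₄, h₄₅]) (by linarith only [h₁, h₁₂, h₂, h₂₃, h₃, h₃₄, h₄₅]) (by linarith only [h₁, h₁₂, h₂, h₂₃, h₃, h₃₄, h₄₅])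
            have su3 : ((u₃ - u₁) * (u₃ - v₂) * (u₃ - u₃)) = 0 := by ring
            have su4 : 0 ≤ ((u₄ - u₁) * (u₄ - v₂) * (u₄ - u₃)) := by
              have a1 : 0 ≤ u₄ - u₁ := by linarith only [h₁, h₁₂, h₂, h₂₃, h₃, h₃₄, h₄₅]
              have a2 : 0 ≤ u₄ - v₂ := by linarith only [h₁, h₁₂, h₂, h₂₃, h₃, h₃₄, h₄₅]
              have a3 : 0 ≤ u₄ - u₃ := by linarith only [h₁, h₁₂, h₂, h₂₃, h₃, h₃₄, h₄₅]
              positivity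
            have su5 : 0 ≤ ((u₅ - u₁) * (u₅ - v₂) * (u₅ - u₃)) := by
              have a1 : 0 ≤ u₅ - u₁ := by linarith only [h₁, h₁₂, h₂, h₂₃, h₃, h₃₄, h₄₅]
              have a2 : 0 ≤ u₅ - v₂ := by linarith only [h₁, h₁₂, h₂, h₂₃, h₃, h₃₄, h₄₅]
              have a3 : 0 ≤ u₅ - u₃ := by linarith only [h₁, h₁₂, h₂, h₂₃, h₃, h₃₄, h₄₅]
              positivity
            have sv1 : ((v₁ - u₁) * (v₁ - v₂) * (v₁ - u₃)) < 0 := prod3_neg_nnn _ _ _ (by linarith only [h₁, h₁₂, h₂, h₂₃, h₃, h₃₄, h₄₅]) (by linarith only [h₁, h₁₂, h₂, h₂₃, h₃, h₃₄, h₄₅]) (by linarith only [h₁, h₁₂, h₂, h₂₃, h₃, h₃₄, h₄₅])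
            have sv2 : ((v₂ - u₁) * (v₂ - v₂) * (v₂ - u₃)) = 0 := by ring
            have sv3 : ((v₃ - u₁) * (v₃ - v₂) * (v₃ - u₃)) ≤ 0 := prod3_nonpos_ppn _ _ _ (by linarith only [h₁, h₁₂, h₂, h₂₃, h₃, h₃₄, h₄₅]) (by linarith only [h₁, h₁₂, h₂, h₂₃, h₃, h₃₄, h₄₅]) (by linarith only [h₁, h₁₂, h₂, h₂₃, h₃, h₃₄, h₄₅])
            have sr : ((ρ - u₁) * (ρ - v₂) * (ρ - u₃)) < 0 := prod3_neg_nnn _ _ _ (by linarith only [h1p]) (by linarith only [h₁, h₁₂, h₂, h₂₃, h₃, h₃₄, h₄₅, h1p]) (by linarith only [h₁, h₁₂, h₂, h₂₃, h₃, h₃₄, h₄₅, h1p])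
            have sm : (((-ρ) - u₁) * ((-ρ) - v₂) * ((-ρ) - u₃)) < 0 := prod3_neg_nnn _ _ _ (by linarith only [h1p, hρ]) (by linarith only [h₁, h₁₂, h₂, h₂₃, h₃, h₃₄, h₄₅, h1p, hρ]) (by linarith only [h₁, h₁₂, h₂, h₂₃, h₃, h₃₄, h₄₅, h1p, hρ])
            linarith only [ct, su1, su2, su3, su4, su5, sv1, sv2, sv3, sr, sm]
  -- conclusion from ℓ(u₅) < 0: the wall of u₅ is negative
  have hw5neg : (u₅ ^ 2 - ((u₁ ^ 2 + u₂ ^ 2 + u₃ ^ 2 + u₄ ^ 2 + u₅ ^ 2) - (v₁ ^ 2 + v₂ ^ 2 + v₃ ^ 2)) / 2) < 0 := by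
    have h : (u₅ ^ 2 - ((u₁ ^ 2 + u₂ ^ 2 + u₃ ^ 2 + u₄ ^ 2 + u₅ ^ 2) - (v₁ ^ 2 + v₂ ^ 2 + v₃ ^ 2)) / 2) * ((u₅ - v₁) * (u₅ - v₂) * (u₅ - v₃)) < 0 := by rw [hq5]; exact hlu5
    exact neg_of_mul_neg_of_pos _ _ h hC5
  have i5 := inside_of_wall_neg u₅ ρ ((u₁ ^ 2 + u₂ ^ 2 + u₃ ^ 2 + u₄ ^ 2 + u₅ ^ 2) - (v₁ ^ 2 + v₂ ^ 2 + v₃ ^ 2)) hρ hρ2 hw5neg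
  exact ⟨lt_neg_of_wall_pos_of_lt u₂ u₅ ρ ((u₁ ^ 2 + u₂ ^ 2 + u₃ ^ 2 + u₄ ^ 2 + u₅ ^ 2) - (v₁ ^ 2 + v₂ ^ 2 + v₃ ^ 2)) hρ2 hw2 (by linarith only [h₁, h₁₂, h₂, h₂₃, h₃, h₃₄, h₄₅]) i5.2, i5.1, i5.2⟩

end Summit.HodgeConjecture.HodgeConjecture.WeilClassTestFormatFiveThreeTypes022
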